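import Mathlib
import Literature.Analysis.FluidPDE.VorticityStretching
import Literature.Analysis.FluidPDE.VectorCalculusProofs
import Summits.NavierStokesRegularity.NavierStokesRegularity.Theorems.ThreadingFluxCentreJetVorticityJet
import Summits.NavierStokesRegularity.NavierStokesRegularity.Theorems.ThreadingFluxCentreJetLowestTermExpansion
import HarnessLib

/-!
# Crux `PoloidalLiouville` (stmt-NavierStokesRegularity-1222, wall W1), crux idea «steady-centre-sieve» (ns-idea-15):
# JET FACTS — the lowest Taylor term of the vorticity at an unthreaded steady centre with zero drift

Support file (`--supports stmt-NavierStokesRegularity-1222`, helper; cell `ns-wall-extremal`, ns-wall-eng-7 g6, 0 kit).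
Layer (3) of the kernel proof of L1 `CentreJet.TriaxialToroidalJetRigidity` (CentreJetSketch l.317).

Setting (LOCALISED at `x₀`, so that the ball version is a corollary): `V ∈ C³(ℝ³)`, `p ∈ C²(ℝ³)` globally, `V` of class `C^ω`
at `x₀`, the steady Navier–Stokes equation `DV(x)[V(x)] + ∇p(x) = ΔV(x)` and `div V = 0`, `⟪x − x₀, curl V(x)⟫ = 0` holding
NEAR `x₀`, and `V(x₀) = 0`.  Let `ω := curl V` and let `P(y) := Dᵏω(x₀)(y,…,y)` where all diagonal Taylor terms of `ω` of
degree `< k` vanish.  Then: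

* `laplacian_curl_eventuallyEq` — the steady VORTICITY EQUATION near `x₀`: `Δω = curl((V·∇)V)` (tree `curl_laplacian`,
  `curl_gradient_eq_zero_holds`);
* `inner_laplacian_curl_eventually` — the LOOP LAW in raw form near `x₀`: `⟪x − x₀, Δω(x)⟫ = 0` (tree `laplacian_inner_sub_eq`
  + `divergence_curl_eq_zero_holds`);
* (J2) `divergence_lowestTerm` — `div P = 0`;  (J3) `tangent_lowestTerm` — `⟪y, P(y)⟫ = 0`;
* (J4) `laplacian_lowestTerm` — `ΔP = 0` (the right-hand side of the vorticity equation is `O(‖y‖ᵏ)` at the centre);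
* (J5) `loopLaw_lowestTerm` — `⟪y, DP(y)[Sy] − S P(y)⟫ = 0` with `S = DV(x₀)`.

These are exactly the hypotheses of the algebraic core `HarmonicTangent.harmonicTangentRigidity` (file (1)) once `P` is written
in the eigenframe of `S` as a polynomial field (file (4)).  HONEST FRAME: helper lemmas about one crux idea's objects; closes no
crux or sketch Prop; `PoloidalLiouville` (1222) and NS regularity OPEN.
-/

-- the summit and its single sub-problem share the name (CONVENTIONS §1)
set_option linter.dupNamespace false

noncomputable section

namespace Summit.NavierStokesRegularity.NavierStokesRegularity.Theorems.PoloidalLiouville.CentreJet.LowestTerm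

open Set Function Filter Topology Asymptotics InnerProductSpace
open scoped ContDiff Nat RealInnerProductSpace
open Literature.Analysis.FluidPDE

variable {V : E3 → E3} {p : E3 → ℝ} {x₀ : E3}

/-! ### Regularity of the players at `x₀` -/

/-- `curl V` is of class `C^ω` at `x₀` if `V` is. -/
theorem contDiffAt_curl_omega (hVω : ContDiffAt ℝ ω V x₀) : ContDiffAt ℝ ω (curl V) x₀ := by
  rw [curl_eq_curlCLM_comp]
  exact curlCLM.contDiff.contDiffAt.comp x₀ (hVω.fderiv_right le_top)

/-- The convective term `x ↦ DV(x)[V(x)]` is of class `C^ω` at `x₀` if `V` is. -/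
theorem contDiffAt_convect_omega (hVω : ContDiffAt ℝ ω V x₀) :
    ContDiffAt ℝ ω (fun x => fderiv ℝ V x (V x)) x₀ :=
  (hVω.fderiv_right le_top).clm_apply hVω

/-- `curl` of the convective term is of class `C^ω` at `x₀` if `V` is. -/
theorem contDiffAt_curl_convect_omega (hVω : ContDiffAt ℝ ω V x₀) :
    ContDiffAt ℝ ω (curl fun x => fderiv ℝ V x (V x)) x₀ := by
  rw [curl_eq_curlCLM_comp]
  exact curlCLM.contDiff.contDiffAt.comp x₀ ((contDiffAt_convect_omega hVω).fderiv_right le_top)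

/-! ### The steady vorticity equation and the raw loop law near the centre -/

/-- **Steady vorticity equation near `x₀`**: if `DV[V] + ∇p = ΔV` near `x₀` (`V ∈ C³`, `p ∈ C²`) then
`Δ(curl V) = curl (x ↦ DV(x)[V(x)])` near `x₀`. -/
theorem laplacian_curl_eventuallyEq (hV : ContDiff ℝ 3 V) (hp : ContDiff ℝ 2 p)
    (hNS : ∀ᶠ x in 𝓝 x₀, fderiv ℝ V x (V x) + gradient p x = Laplacian.laplacian V x) :
    (Laplacian.laplacian (curl V)) =ᶠ[𝓝 x₀] curl fun x => fderiv ℝ V x (V x) := by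
  have hV2 : ContDiff ℝ 2 V := hV.of_le (by norm_num)
  filter_upwards [eventually_eventuallyEq_nhds.2 hNS |>.mono fun x hx => hx] with x hx
  -- `hx : ∀ᶠ z in 𝓝 x, DV[V] + ∇p = ΔV`
  have hΔ : Laplacian.laplacian V =ᶠ[𝓝 x] fun z => fderiv ℝ V z (V z) + gradient p z :=
    hx.mono fun z hz => hz.symm
  rw [← curl_laplacian hV x, curl_eq_curlCLM, hΔ.fderiv_eq, ← curl_eq_curlCLM]
  have hd1 : DifferentiableAt ℝ (fun z => fderiv ℝ V z (V z)) x :=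
    (((hV2.fderiv_right (m := 1) (by norm_num)).clm_apply (hV2.of_le (by norm_num))).differentiable
      one_ne_zero).differentiableAt
  have hd2 : DifferentiableAt ℝ (gradient p) x := by
    have : ContDiff ℝ 1 (gradient p) := by
      have h := hp.fderiv_right (m := 1) (by norm_num)
      exact (InnerProductSpace.toDual ℝ E3).symm.contDiff.comp h
    exact (this.differentiable one_ne_zero).differentiableAt
  rw [curl_add hd1 hd2, curl_gradient_eq_zero_holds p hp x, add_zero]

/-- **Raw loop law near `x₀`**: if `curl V` is tangent to the spheres about `x₀` near `x₀` (`V ∈ C³`) then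
`⟪x − x₀, Δ(curl V)(x)⟫ = 0` near `x₀` (`Δ⟪x − x₀, ω⟫ = 2 div ω + ⟪x − x₀, Δω⟫` and `div curl = 0`). -/
theorem inner_laplacian_curl_eventually (hV : ContDiff ℝ 3 V) (htan : ∀ᶠ x in 𝓝 x₀, ⟪x - x₀, curl V x⟫ = 0) :
    ∀ᶠ x in 𝓝 x₀, ⟪x - x₀, Laplacian.laplacian (curl V) x⟫ = 0 := by
  have hω2 : ContDiff ℝ 2 (curl V) := contDiff_curl (n := 2) (by exact_mod_cast hV)
  have hV2 : ContDiff ℝ 2 V := hV.of_le (by norm_num)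
  filter_upwards [eventually_eventuallyEq_nhds.2 htan |>.mono fun x hx => hx] with x hx
  have h := laplacian_inner_sub_eq hω2 x₀ x
  have h0 : Laplacian.laplacian (fun z : E3 => ⟪z - x₀, curl V z⟫) x = 0 := by
    have hz : (fun z : E3 => ⟪z - x₀, curl V z⟫) =ᶠ[𝓝 x] fun _ => (0 : ℝ) := hx
    rw [(laplacian_congr_nhds hz).eq_of_nhds, laplacian_const]
    rfl
  rw [h0, divergence_curl_eq_zero_holds V hV2 x, mul_zero, zero_add] at h
  exact h.symm

/-! ### (J3) tangency of the lowest term -/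

/-- Pull-back of an eventual statement at `x₀` along `y ↦ x₀ + y`. -/
theorem eventually_nhds_zero_of_eventually {q : E3 → Prop} (h : ∀ᶠ x in 𝓝 x₀, q x) : ∀ᶠ y in 𝓝 (0 : E3), q (x₀ + y) := by
  have ht : Tendsto (fun y : E3 => x₀ + y) (𝓝 0) (𝓝 x₀) := by
    have h1 : Tendsto (fun y : E3 => x₀ + y) (𝓝 0) (𝓝 (x₀ + 0)) := tendsto_const_nhds.add tendsto_id
    rwa [add_zero] at h1
  exact ht.eventually h

/-- Products with `⟪y, ·⟫`: if `r = O(‖y‖ⁿ)` then `⟪y, r(y)⟫ = O(‖y‖ⁿ⁺¹)`. -/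
theorem inner_isBigO {r : E3 → E3} {n : ℕ} (hr : r =O[𝓝 0] fun y : E3 => ‖y‖ ^ n) :
    (fun y : E3 => ⟪y, r y⟫) =O[𝓝 0] fun y : E3 => ‖y‖ ^ (n + 1) := by
  have hy : (fun y : E3 => (innerSL ℝ y : E3 →L[ℝ] ℝ)) =O[𝓝 0] fun y : E3 => ‖y‖ ^ 1 :=
    IsBigO.of_bound 1 (Eventually.of_forall fun y => by
      rw [innerSL_apply_norm, pow_one, one_mul, Real.norm_of_nonneg (norm_nonneg _)])
  have h := isBigO_clm_apply hy hr
  refine h.trans (IsBigO.of_bound' (Eventually.of_forall fun y => ?_))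
  rw [← pow_add, add_comm]

/-- **(J3) The lowest term is tangent to the spheres**: `⟪y, Dᵏω(x₀)(y,…,y)⟫ = 0`. -/
theorem tangent_lowestTerm (hVω : ContDiffAt ℝ ω V x₀) (htan : ∀ᶠ x in 𝓝 x₀, ⟪x - x₀, curl V x⟫ = 0) {k : ℕ}
    (hlow : ∀ n < k, ∀ y : E3, iteratedFDeriv ℝ n (curl V) x₀ (fun _ => y) = 0) (y : E3) :
    ⟪y, iteratedFDeriv ℝ k (curl V) x₀ (fun _ => y)⟫ = 0 := by
  have hω := contDiffAt_curl_omega hVω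
  -- the normalised term `g(y) = ⟪y, Pₙ y⟫` is `(k+1)`-homogeneous and `O(‖y‖^(k+2))`
  set g : E3 → ℝ := fun y => ⟪y, ((k ! : ℝ)⁻¹) • iteratedFDeriv ℝ k (curl V) x₀ (fun _ => y)⟫ with hg
  have hhom : ∀ (c : ℝ) (z : E3), g (c • z) = c ^ (k + 1) • g z := fun c z => by
    simp only [hg, JetCalculus.diag_smul, real_inner_smul_left, real_inner_smul_right, smul_eq_mul]
    ring
  have hO : g =O[𝓝 0] fun z : E3 => ‖z‖ ^ (k + 1 + 1) := by
    have h1 := inner_isBigO (sub_lowest_isBigO hω hlow)   -- `⟪y, ω(x₀+y) − Pₙ y⟫ = O(‖y‖^(k+2))`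
    have h2 : (fun y : E3 => ⟪y, curl V (x₀ + y)⟫) =O[𝓝 0] fun z : E3 => ‖z‖ ^ (k + 1 + 1) := by
      refine (isBigO_zero _ _).congr' ?_ EventuallyEq.rfl
      filter_upwards [eventually_nhds_zero_of_eventually htan] with y hy
      simpa using hy.symm
    refine (h2.sub h1).congr (fun y => ?_) (fun _ => rfl)
    simp only [hg, inner_sub_right]
    ring
  have h0 := AnalyticOrder.eq_zero_of_homogeneous_of_isBigO hhom hO y
  simp only [hg, real_inner_smul_right, mul_eq_zero, inv_eq_zero, Nat.cast_eq_zero] at h0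
  exact h0.resolve_left (Nat.factorial_ne_zero k)

/-! ### (J2) divergence of the lowest term -/

/-- **(J2) The lowest term is divergence free**: `div (y ↦ Dᵏω(x₀)(y,…,y)) = 0` — in fact for EVERY `k`, since `div curl V ≡ 0`. -/
theorem divergence_lowestTerm (hV : ContDiff ℝ 2 V) (hVω : ContDiffAt ℝ ω V x₀) (k : ℕ) (y : E3) :
    VectorCalculus.divergence (fun y : E3 => iteratedFDeriv ℝ k (curl V) x₀ (fun _ => y)) y = 0 := by
  have hω := contDiffAt_curl_omega hVω
  cases k with
  | zero =>
    have : (fun y : E3 => iteratedFDeriv ℝ 0 (curl V) x₀ (fun _ => y)) = fun _ => curl V x₀ := by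
      funext z; simp
    rw [this, VectorCalculus.divergence]
    simp
  | succ m =>
    set b := EuclideanSpace.basisFun (Fin 3) ℝ
    rw [divergence_eq_sum_inner_fderiv b]
    have hterm : ∀ i, ⟪b i, fderiv ℝ (fun y : E3 => iteratedFDeriv ℝ (m + 1) (curl V) x₀ (fun _ => y)) y (b i)⟫ =
        ((m : ℝ) + 1) * iteratedFDeriv ℝ m (fun z => ⟪b i, fderiv ℝ (curl V) z (b i)⟫) x₀ (fun _ => y) := by
      intro i
      rw [JetCalculus.fderiv_diag_succ hω m y (b i), real_inner_smul_right]
      congr 1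
      have hci : ContDiffAt ℝ m (fun z => fderiv ℝ (curl V) z (b i)) x₀ :=
        (JetCalculus.contDiffAt_fderiv_apply hω (b i)).of_le le_top
      have h := JetCalculus.diag_clm_apply (innerSL ℝ (b i)) hci y
      simpa using h.symm
    simp only [hterm]
    rw [← Finset.mul_sum]
    have hci : ∀ i ∈ Finset.univ, ContDiffAt ℝ m (fun z => ⟪b i, fderiv ℝ (curl V) z (b i)⟫) x₀ := fun i _ =>
      ((innerSL ℝ (b i)).contDiff.contDiffAt.comp x₀ ((JetCalculus.contDiffAt_fderiv_apply hω (b i)).of_le le_top))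
    rw [← JetCalculus.diag_sum Finset.univ hci]
    have hdiv : (fun z => ∑ i ∈ Finset.univ, ⟪b i, fderiv ℝ (curl V) z (b i)⟫) = fun _ => (0 : ℝ) := by
      funext z
      rw [← divergence_eq_sum_inner_fderiv b, divergence_curl_eq_zero_holds V hV z]
    rw [hdiv]
    rcases Nat.eq_zero_or_pos m with rfl | hm
    · simp
    · rw [iteratedFDeriv_const_of_ne (by omega)]
      simp

/-! ### The curl of the convective term is `O(‖y‖ᵏ)` at the centre -/

/-- With zero drift, `curl((V·∇)V)(x₀ + y) = O(‖y‖ᵏ)` where `k` is the order of vanishing of `ω = curl V` at `x₀`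
(for `k = m + 1`; by the tree's `curl_convect_self`, `curl((V·∇)V) = (V·∇)ω − (ω·∇)V + (div V) ω`). -/
theorem curl_convect_isBigO (hV : ContDiff ℝ 2 V) (hVω : ContDiffAt ℝ ω V x₀) (hdiv : ∀ᶠ x in 𝓝 x₀, VectorCalculus.divergence V x = 0)
    (h0 : V x₀ = 0) {m : ℕ} (hlow : ∀ n < m + 1, ∀ y : E3, iteratedFDeriv ℝ n (curl V) x₀ (fun _ => y) = 0) :
    (fun y : E3 => curl (fun x => fderiv ℝ V x (V x)) (x₀ + y)) =O[𝓝 0] fun y : E3 => ‖y‖ ^ (m + 1) := by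
  have hω := contDiffAt_curl_omega hVω
  -- the bracket `(V·∇)ω − (ω·∇)V` is `Q + O(‖y‖^(m+2))` with `Q = O(‖y‖^(m+1))`
  have h1 := convect_sub_lowest_isBigO hVω hω h0 hlow
  have h2 := loopTerm_isBigO hω m (fderiv ℝ V x₀) (fderiv ℝ V x₀)
  have h3 := (h1.trans (isBigO_norm_pow_of_le (E := E3) (Nat.le_succ (m + 1)))).add h2
  -- the `(div V) ω` term vanishes near the centre
  refine (h3.congr' ?_ EventuallyEq.rfl)
  filter_upwards [eventually_nhds_zero_of_eventually hdiv] with y hy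
  have hc := curl_convect_self hV (x₀ + y)
  simp only [convect_apply] at hc
  have hcv : (convect V V) = fun x => fderiv ℝ V x (V x) := rfl
  rw [hcv] at hc
  rw [hc, hy, zero_smul, add_zero]
  abel

/-! ### (J4) the lowest term is harmonic -/

/-- **(J4) The lowest term is HARMONIC**: `Δ (y ↦ Dᵏω(x₀)(y,…,y)) = 0` — the steady vorticity equation read at order `k − 2`:
its right-hand side `curl((V·∇)V)` is `O(‖y‖ᵏ)` at a centre with zero drift. -/
theorem laplacian_lowestTerm (hV : ContDiff ℝ 3 V) (hp : ContDiff ℝ 2 p) (hVω : ContDiffAt ℝ ω V x₀)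
    (hNS : ∀ᶠ x in 𝓝 x₀, fderiv ℝ V x (V x) + gradient p x = Laplacian.laplacian V x)
    (hdiv : ∀ᶠ x in 𝓝 x₀, VectorCalculus.divergence V x = 0) (h0 : V x₀ = 0) {k : ℕ}
    (hlow : ∀ n < k, ∀ y : E3, iteratedFDeriv ℝ n (curl V) x₀ (fun _ => y) = 0) (y : E3) :
    Laplacian.laplacian (fun y : E3 => iteratedFDeriv ℝ k (curl V) x₀ (fun _ => y)) y = 0 := by
  have hω := contDiffAt_curl_omega hVω
  have hV2 : ContDiff ℝ 2 V := hV.of_le (by norm_num)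
  rcases k with _ | _ | m
  · -- `k = 0`: constant
    have : (fun y : E3 => iteratedFDeriv ℝ 0 (curl V) x₀ (fun _ => y)) = fun _ => curl V x₀ := by
      funext z; simp
    rw [this, laplacian_const]
    rfl
  · -- `k = 1`: linear
    have hlin : (fun y : E3 => iteratedFDeriv ℝ 1 (curl V) x₀ (fun _ => y)) = fun y => fderiv ℝ (curl V) x₀ y := by
      funext z; simp
    rw [hlin, congrFun (laplacian_eq_iteratedFDeriv_orthonormalBasis (fun y => fderiv ℝ (curl V) x₀ y)
      (EuclideanSpace.basisFun (Fin 3) ℝ)) y]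
    refine Finset.sum_eq_zero fun i _ => ?_
    rw [iteratedFDeriv_two_apply]
    have hD : fderiv ℝ (fun y => fderiv ℝ (curl V) x₀ y) = fun _ => fderiv ℝ (curl V) x₀ := by
      funext z; exact (fderiv ℝ (curl V) x₀).fderiv
    rw [hD]
    simp
  · -- `k = m + 2`: the vorticity equation at order `m`
    rw [JetCalculus.laplacian_diag hω m y]
    suffices h : iteratedFDeriv ℝ m (Laplacian.laplacian (curl V)) x₀ (fun _ => y) = 0 by
      rw [h, smul_zero]
    rw [JetCalculus.diag_congr (laplacian_curl_eventuallyEq hV hp hNS) m y]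
    have hN := curl_convect_isBigO hV2 hVω hdiv h0 (m := m + 1) hlow
    exact AnalyticOrder.diag_eq_zero_of_isBigO (contDiffAt_curl_convect_omega hVω).analyticAt hN m (by omega) y

/-! ### (J5) the loop law at lowest order -/

/-- **(J5) The LOOP LAW at lowest order**: `⟪y, DP(y)[Sy] − S P(y)⟫ = 0` with `P(y) = Dᵏω(x₀)(y,…,y)` and `S = DV(x₀)` —
the `(k+1)`-st Taylor term of the identity `⟪x − x₀, Δω⟫ = 0` combined with the vorticity equation. -/
theorem loopLaw_lowestTerm (hV : ContDiff ℝ 3 V) (hp : ContDiff ℝ 2 p) (hVω : ContDiffAt ℝ ω V x₀)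
    (hNS : ∀ᶠ x in 𝓝 x₀, fderiv ℝ V x (V x) + gradient p x = Laplacian.laplacian V x)
    (hdiv : ∀ᶠ x in 𝓝 x₀, VectorCalculus.divergence V x = 0) (htan : ∀ᶠ x in 𝓝 x₀, ⟪x - x₀, curl V x⟫ = 0)
    (h0 : V x₀ = 0) {k : ℕ} (hlow : ∀ n < k, ∀ y : E3, iteratedFDeriv ℝ n (curl V) x₀ (fun _ => y) = 0) (y : E3) :
    ⟪y, fderiv ℝ (fun y : E3 => iteratedFDeriv ℝ k (curl V) x₀ (fun _ => y)) y (fderiv ℝ V x₀ y) -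
      fderiv ℝ V x₀ (iteratedFDeriv ℝ k (curl V) x₀ (fun _ => y))⟫ = 0 := by
  have hω := contDiffAt_curl_omega hVω
  have hV2 : ContDiff ℝ 2 V := hV.of_le (by norm_num)
  set S := fderiv ℝ V x₀ with hS
  rcases k with _ | m
  · -- `k = 0`: the constant term vanishes by tangency
    have hz : curl V x₀ = 0 := by
      have h := tangent_lowestTerm hVω htan (k := 0) (fun n hn => absurd hn (Nat.not_lt_zero n)) (curl V x₀)
      simpa using h
    have : (fun y : E3 => iteratedFDeriv ℝ 0 (curl V) x₀ (fun _ => y)) = fun _ => 0 := by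
      funext z; simp [hz]
    rw [this]
    simp [hz]
  · -- `k = m + 1`
    set c : ℝ := ((m + 1) ! : ℝ) with hc
    have hc0 : c ≠ 0 := by rw [hc]; exact_mod_cast Nat.factorial_ne_zero (m + 1)
    set Pn : E3 → E3 := fun y => c⁻¹ • iteratedFDeriv ℝ (m + 1) (curl V) x₀ (fun _ => y) with hPn
    have hPnd : ∀ z, DifferentiableAt ℝ Pn z := fun z => by
      have h : HasFDerivAt Pn
          (c⁻¹ • fderiv ℝ (fun y : E3 => iteratedFDeriv ℝ (m + 1) (curl V) x₀ (fun _ => y)) z) z :=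
        (JetCalculus.differentiable_diag (f := curl V) (x₀ := x₀) (m + 1) z).hasFDerivAt.const_smul c⁻¹
      exact h.differentiableAt
    -- the normalised loop term and its pairing with `y`
    set g : E3 → ℝ := fun y => ⟪y, fderiv ℝ Pn y (S y) - S (Pn y)⟫ with hg
    -- homogeneity of degree `m + 2`
    have hfd : ∀ (a : ℝ) (z e : E3), fderiv ℝ Pn (a • z) e = a ^ m • fderiv ℝ Pn z e := fun a z e => by
      simp only [hPn]
      rw [fderiv_fun_const_smul (JetCalculus.differentiable_diag (m + 1) (a • z)),
        fderiv_fun_const_smul (JetCalculus.differentiable_diag (m + 1) z), smul_apply, smul_apply,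
        JetCalculus.fderiv_diag_succ_smul hω m a z e, smul_comm]
    have hhom : ∀ (a : ℝ) (z : E3), g (a • z) = a ^ (m + 2) • g z := fun a z => by
      have hP : Pn (a • z) = a ^ (m + 1) • Pn z := by
        simp only [hPn, JetCalculus.diag_smul]; rw [smul_comm]
      simp only [hg]
      rw [map_smul, map_smul, hfd, hP, map_smul, smul_smul, show a * a ^ m = a ^ (m + 1) by ring, ← smul_sub,
        real_inner_smul_left, real_inner_smul_right, smul_eq_mul]
      ring
    -- `g = O(‖y‖^(m+3))`
    have hO : g =O[𝓝 0] fun z : E3 => ‖z‖ ^ (m + 2 + 1) := by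
      -- the convective bracket minus the loop term is small
      have h1 := convect_sub_lowest_isBigO hVω hω h0 hlow
      have h1' := inner_isBigO h1.neg_left
      -- `⟪y, (V·∇)ω − (ω·∇)V⟫ = 0` near `0`: vorticity equation + raw loop law + `div V = 0`
      have h2 : (fun y : E3 => ⟪y, fderiv ℝ (curl V) (x₀ + y) (V (x₀ + y)) - fderiv ℝ V (x₀ + y) (curl V (x₀ + y))⟫)
          =O[𝓝 0] fun z : E3 => ‖z‖ ^ (m + 2 + 1) := by
        refine (isBigO_zero _ _).congr' ?_ EventuallyEq.rfl
        filter_upwards [eventually_nhds_zero_of_eventually hdiv,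
          eventually_nhds_zero_of_eventually (inner_laplacian_curl_eventually hV htan),
          eventually_nhds_zero_of_eventually (laplacian_curl_eventuallyEq hV hp hNS)] with y hy hL hE
        have hc' := curl_convect_self hV2 (x₀ + y)
        simp only [convect_apply] at hc'
        have hcv : (convect V V) = fun x => fderiv ℝ V x (V x) := rfl
        rw [hcv, hy, zero_smul, add_zero] at hc'
        rw [← hc', ← hE]
        simpa using hL.symm
      refine (h2.add h1').congr (fun z => ?_) (fun _ => rfl)
      simp only [hg, hPn, hS, hc]
      rw [← inner_add_right]
      congr 1
      abel
    have hg0 := AnalyticOrder.eq_zero_of_homogeneous_of_isBigO hhom hO y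
    -- unnormalise
    have e2 : iteratedFDeriv ℝ (m + 1) (curl V) x₀ (fun _ => y) = c • Pn y := by
      simp only [hPn, smul_smul, mul_inv_cancel₀ hc0, one_smul]
    have hPPn : (fun y : E3 => iteratedFDeriv ℝ (m + 1) (curl V) x₀ (fun _ => y)) = fun y => c • Pn y := by
      funext z
      simp only [hPn, smul_smul, mul_inv_cancel₀ hc0, one_smul]
    have e1 : fderiv ℝ (fun y : E3 => iteratedFDeriv ℝ (m + 1) (curl V) x₀ (fun _ => y)) y (S y) =
        c • fderiv ℝ Pn y (S y) := by
      rw [hPPn, fderiv_fun_const_smul (hPnd y), smul_apply]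
    rw [e1, e2, map_smul, ← smul_sub, real_inner_smul_right]
    simp only [hg] at hg0
    rw [hg0, mul_zero]

end Summit.NavierStokesRegularity.NavierStokesRegularity.Theorems.PoloidalLiouville.CentreJet.LowestTerm

end
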